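import Literature.IUT.HodgeTheaters.InitialThetaDataLocalSlim
import Literature.AnabelianGeometry.AbsoluteAnabelian.AbsAnabFundamentalGroupsOrbicurveModelProofs
import HarnessLib

/-!
# [IUTchI] Example 3.3 (iii) (c) for the initial Θ-datum AT THE QUOTIENT-ORBICURVE MODEL of `Δ_C` —
# the slimness input `IsSlimGroup D.DeltaC` discharged from a surface-group presentation of `Δ_X`

S. Mochizuki, *Inter-universal Teichmüller theory I*, kurims manuscript (May 2020), Example 3.3 (iii) p. 79:
"(c) the category `𝒟_v` may be reconstructed category-theoretically from `ℱ̲_v = 𝒞_v` [cf. … [AbsAnab], Lemma 1.3.1]"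
[claim: Mochizuki2012, status: disputed] (D-0012 claim key, series status DISPUTED — this file is a PROOF-ONLY
composition of landed theorems; nothing of the series is asserted and no side is taken on [IUTchIII] Cor. 3.12);
Definition 3.1 (b) p. 61: "`X_F` … a once-punctured elliptic curve … `C_F` … the hyperbolic orbicurve …
obtained by forming the stack-theoretic quotient of `X_F` by the unique `F`-involution … `−1` of `X_F`".
S. Mochizuki, *The absolute anabelian geometry of hyperbolic curves* (2004), Lemma 1.3.1 p. 15 ("the profinite
groups `Δ_X`, `Π_X` are slim") [cite: MochizukiAbsAnab2004, Lemma 1.3.1 p.15]; *Topics in Absolute Anabelian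
Geometry I* (2012), Prop. 2.3 (i) p. 19 (hyperbolic ORBICURVES) [cite: MochizukiAbsTopI2012, Prop 2.3 (i) p.19].

abc-iut cell, block F seat abc-iut-f-051 (gen 3); a by-name sequel of abc-iut-L5's
`InitialThetaDataLocalSlim.lean` (node IUTchI:Ex3.3(iii), clause (c)), whose closers take the slimness of
`Δ_C = D.DeltaC` as the hypothesis `hΔ : IsSlimGroup D.DeltaC` (resp. the frozen fact F-0004
`GeomAndArithSlim D.geom.extF` BY NAME).  For the ABSTRACT interface `ThetaGeometry` that hypothesis is not
derivable (the geometric origin of `Δ_C` is not part of the datum).  Here it is DERIVED from MODEL DATA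
describing that origin, by abc-iut-f-051's quotient-orbicurve theorem
(`FundamentalExtension.isSlimGroup_geom_of_indexTwoInv_arith`, `AbsAnabFundamentalGroupsOrbicurveModelProofs.lean`,
over `ProfiniteIndexTwoInversionSlim.lean`; non-vacuity `ProfiniteIndexTwoInversionModel.lean`):

  a presentation `ι : Γ_{g,r} → Δ_X := Π_{X_F} ∩ Δ_C` of `Δ_X` as a pro-`Σ` completion of a hyperbolic
  surface group (`Σ` a nonempty set of primes; for `X_F = E_F ∖ {O}`: `(g, r) = (1, 1)`), such that every
  `z ∈ Δ_C ∖ Π_{X_F}` acts on `Δ_X^{ab}` by inversion (`z x z⁻¹ x ∈ closure [Δ_X, Δ_X]` — the involution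
  `−1` of `E_F` acts as `−1` on `H₁`),

the index-2 data `Π_{X_F} ⊆ Π_{C_F}` open, `[Π_{C_F} : Π_{X_F}] = 2`, `aug(Π_{X_F}) = G_F` being the datum's own
fields `ThetaGeometry.PiX_isOpen / PiX_index / aug_PiX`.

* `InitialThetaData.isSlimGroup_deltaC_of_indexTwoInv` — `Δ_C` is slim;
* `InitialThetaData.geomSlimElastic_extF_of_indexTwoInv` — `Δ_C` is slim and elastic ([AbsTopI] Prop 2.3 (i));
* `InitialThetaData.dFromF_goodLocalFrobenioid_of_indexTwoInv`, `…OfEmb…`, `…At…` — Ex. 3.3 (iii) (c) at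
  `v̲ ∈ V̲^good ∩ V̲^non` (model field `k`, chosen / given embedding, actual place `w ∣ p`);
* `InitialThetaData.basesFromC_and_dFromF_goodLocalFrobenioid_of_indexTwoInv` — (b) ∧ (c).

HONEST SCOPE: the model data above are HYPOTHESES on `D` (what a geometric construction of `Π_{C_F}` would
supply); one-line compositions; no definition, no named fact; typed ≠ proved elsewhere.
-/

namespace Literature.IUT.HodgeTheaters

open Literature.AlgebraicGeometry.Frobenioids Literature.AlgebraicGeometry.Frobenioids.PadicFrd
open Literature.AnabelianGeometry.AbsoluteAnabelian Literature.AnabelianGeometry.SemiGraphs.SemiGraphOfAnabelioids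
open Literature.GroupTheory.CombinatorialGroupTheory

universe u v

noncomputable section Geom

variable {F : Type u} {K : Type v} {Fbar : Type} [Field F] [NumberField F] [Field K] [NumberField K]
  [Algebra F K] [Field Fbar] [Algebra F Fbar] [Algebra K Fbar]
  {E : WeierstrassCurve F} [E.IsElliptic] {l : ℕ} {Pb : BadPlacePredicates K}
  (D : InitialThetaData F K Fbar E l Pb) {Sigma : Set ℕ} {g r : ℕ}

namespace InitialThetaData

/-- **`Δ_C` is slim at the quotient-orbicurve model** ([AbsAnab] Lemma 1.3.1 / [AbsTopI] Prop 2.3 (i) for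
`C_F = X_F // {±1}`): if `Δ_X := Π_{X_F} ∩ Δ_C` is presented as a pro-`Σ` completion of a hyperbolic `Γ_{g,r}`
(`Σ` a nonempty set of primes) and `Δ_C ∖ Π_{X_F}` acts on `Δ_X^{ab}` by inversion, then `Δ_C = D.DeltaC` is
slim. ([IUTchI] Def 3.1 (b) p.61) [claim: Mochizuki2012, status: disputed] -/
theorem isSlimGroup_deltaC_of_indexTwoInv (hS : Sigma.Nonempty) (hSp : ∀ p ∈ Sigma, p.Prime)
    (hgr : PuncturedSurfaceGroup.IsHyperbolicType g r)
    (ι : PuncturedSurfaceGroup g r →* (D.geom.PiX ⊓ D.DeltaC : Subgroup D.PiC))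
    (hι : IsProSigmaCompletion Sigma ι)
    (hinv : ∀ z ∈ D.DeltaC, z ∉ D.geom.PiX → ∀ x ∈ D.geom.PiX ⊓ D.DeltaC,
      z * x * z⁻¹ * x ∈ (⁅D.geom.PiX ⊓ D.DeltaC, D.geom.PiX ⊓ D.DeltaC⁆ : Subgroup D.PiC).topologicalClosure) :
    IsSlimGroup D.DeltaC :=
  D.geom.extF.isSlimGroup_geom_of_indexTwoInv_arith D.geom.PiX D.geom.PiX_isOpen D.geom.PiX_index
    D.geom.aug_PiX hS hSp hgr ι hι hinv

/-- **`Δ_C` is slim and elastic at the quotient-orbicurve model** ([AbsTopI] Prop 2.3 (i) for `C_F`), as the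
typed node predicate `GeomSlimElastic` of the datum's extension `Π_{C_F} ↠ G_F`.
([IUTchI] Def 3.1 (b) p.61) [claim: Mochizuki2012, status: disputed] -/
theorem geomSlimElastic_extF_of_indexTwoInv (hS : Sigma.Nonempty) (hSp : ∀ p ∈ Sigma, p.Prime)
    (hgr : PuncturedSurfaceGroup.IsHyperbolicType g r)
    (ι : PuncturedSurfaceGroup g r →* (D.geom.PiX ⊓ D.DeltaC : Subgroup D.PiC))
    (hι : IsProSigmaCompletion Sigma ι)
    (hinv : ∀ z ∈ D.DeltaC, z ∉ D.geom.PiX → ∀ x ∈ D.geom.PiX ⊓ D.DeltaC,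
      z * x * z⁻¹ * x ∈ (⁅D.geom.PiX ⊓ D.DeltaC, D.geom.PiX ⊓ D.DeltaC⁆ : Subgroup D.PiC).topologicalClosure) :
    D.geom.extF.GeomSlimElastic :=
  D.geom.extF.geomSlimElastic_of_indexTwoInv_arith D.geom.PiX D.geom.PiX_isOpen D.geom.PiX_index
    D.geom.aug_PiX hS hSp hgr ι hι hinv

end InitialThetaData

end Geom

noncomputable section DatumC

variable {F : Type u} {K : Type v} {Fbar : Type} [Field F] [NumberField F] [Field K] [NumberField K]
  [Algebra F K] [Field Fbar] [Algebra F Fbar] [Algebra K Fbar] [IsScalarTower F K Fbar] [Normal K Fbar]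
  {E : WeierstrassCurve F} [E.IsElliptic] {l : ℕ} {Pb : BadPlacePredicates K}
  (D : InitialThetaData F K Fbar E l Pb) (p : ℕ) [Fact p.Prime]
  (k : Type) [NontriviallyNormedField k] [CompleteSpace k] [IsUltrametricDist k] [NormedAlgebra ℚ_[p] k]
  [FiniteDimensional ℚ_[p] k] [Algebra K k] {Sigma : Set ℕ} {g r : ℕ}

namespace InitialThetaData

/-- **[IUTchI] Ex. 3.3 (iii) (c) for `D` at `v̲ ∈ V̲^good ∩ V̲^non`, `K_v̲ = k`, along `ι_k : F̄ → k̄`, AT THE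
QUOTIENT-ORBICURVE MODEL of `Δ_C`** (abc-iut-L5-t2's `dFromF_goodLocalFrobenioidOfEmb_of_geom_slim` with its
slimness input discharged by `isSlimGroup_deltaC_of_indexTwoInv`).
([IUTchI] Ex 3.3 (iii) p.79) [claim: Mochizuki2012, status: disputed] -/
theorem dFromF_goodLocalFrobenioidOfEmb_of_indexTwoInv (hS : Sigma.Nonempty) (hSp : ∀ p ∈ Sigma, p.Prime)
    (hgr : PuncturedSurfaceGroup.IsHyperbolicType g r)
    (ι : PuncturedSurfaceGroup g r →* (D.geom.PiX ⊓ D.DeltaC : Subgroup D.PiC))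
    (hι : IsProSigmaCompletion Sigma ι)
    (hinv : ∀ z ∈ D.DeltaC, z ∉ D.geom.PiX → ∀ x ∈ D.geom.PiX ⊓ D.DeltaC,
      z * x * z⁻¹ * x ∈ (⁅D.geom.PiX ⊓ D.DeltaC, D.geom.PiX ⊓ D.DeltaC⁆ : Subgroup D.PiC).topologicalClosure)
    (ιk : Fbar →ₐ[K] AlgebraicClosure k) (hX : IsOpen (D.PiXarrow : Set D.PiC)) :
    @GoodLocalFrobenioid.DFromF p k _ (GaloisValDatum.normVal k) (D.goodLocalFrobenioidOfEmb p k ιk hX) :=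
  D.dFromF_goodLocalFrobenioidOfEmb_of_geom_slim p k (D.isSlimGroup_deltaC_of_indexTwoInv hS hSp hgr ι hι hinv)
    ιk hX

/-- **[IUTchI] Ex. 3.3 (iii) (c) for `D` at `v̲`, `K_v̲ = k`, chosen embedding, at the quotient-orbicurve model.**
([IUTchI] Ex 3.3 (iii) p.79) [claim: Mochizuki2012, status: disputed] -/
theorem dFromF_goodLocalFrobenioid_of_indexTwoInv (hS : Sigma.Nonempty) (hSp : ∀ p ∈ Sigma, p.Prime)
    (hgr : PuncturedSurfaceGroup.IsHyperbolicType g r)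
    (ι : PuncturedSurfaceGroup g r →* (D.geom.PiX ⊓ D.DeltaC : Subgroup D.PiC))
    (hι : IsProSigmaCompletion Sigma ι)
    (hinv : ∀ z ∈ D.DeltaC, z ∉ D.geom.PiX → ∀ x ∈ D.geom.PiX ⊓ D.DeltaC,
      z * x * z⁻¹ * x ∈ (⁅D.geom.PiX ⊓ D.DeltaC, D.geom.PiX ⊓ D.DeltaC⁆ : Subgroup D.PiC).topologicalClosure)
    (hX : IsOpen (D.PiXarrow : Set D.PiC)) :
    @GoodLocalFrobenioid.DFromF p k _ (GaloisValDatum.normVal k) (D.goodLocalFrobenioid p k hX) :=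
  D.dFromF_goodLocalFrobenioid_of_geom_slim p k (D.isSlimGroup_deltaC_of_indexTwoInv hS hSp hgr ι hι hinv) hX

/-- **[IUTchI] Ex. 3.3 (iii) (b) ∧ (c) for `D` at `v̲`, `K_v̲ = k`, at the quotient-orbicurve model** — the form
`basesFromC_and_dFromF_goodLocalFrobenioid_of_geomAndArithSlim` with the frozen fact F-0004 replaced by the model
data it follows from ((b) is unconditional, abc-iut-L5-t2). ([IUTchI] Ex 3.3 (iii) p.79) [claim: Mochizuki2012, status: disputed] -/
theorem basesFromC_and_dFromF_goodLocalFrobenioid_of_indexTwoInv (hS : Sigma.Nonempty)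
    (hSp : ∀ p ∈ Sigma, p.Prime) (hgr : PuncturedSurfaceGroup.IsHyperbolicType g r)
    (ι : PuncturedSurfaceGroup g r →* (D.geom.PiX ⊓ D.DeltaC : Subgroup D.PiC))
    (hι : IsProSigmaCompletion Sigma ι)
    (hinv : ∀ z ∈ D.DeltaC, z ∉ D.geom.PiX → ∀ x ∈ D.geom.PiX ⊓ D.DeltaC,
      z * x * z⁻¹ * x ∈ (⁅D.geom.PiX ⊓ D.DeltaC, D.geom.PiX ⊓ D.DeltaC⁆ : Subgroup D.PiC).topologicalClosure)
    (hX : IsOpen (D.PiXarrow : Set D.PiC)) :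
    @GoodLocalFrobenioid.BasesFromC p k _ (GaloisValDatum.normVal k) (D.goodLocalFrobenioid p k hX) ∧
      @GoodLocalFrobenioid.DFromF p k _ (GaloisValDatum.normVal k) (D.goodLocalFrobenioid p k hX) :=
  ⟨D.basesFromC_goodLocalFrobenioid p k hX,
    D.dFromF_goodLocalFrobenioid_of_indexTwoInv p k hS hSp hgr ι hι hinv hX⟩

end InitialThetaData

end DatumC

noncomputable section DatumCPlace

open Literature.NumberTheory.NumberFields IsDedekindDomain NumberField

variable {F : Type u} {K : Type} {Fbar : Type} [Field F] [NumberField F] [Field K] [NumberField K]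
  [Algebra F K] [Field Fbar] [Algebra F Fbar] [Algebra K Fbar] [IsScalarTower F K Fbar] [Normal K Fbar]
  {E : WeierstrassCurve F} [E.IsElliptic] {l : ℕ} {Pb : BadPlacePredicates K}
  (D : InitialThetaData F K Fbar E l Pb) (w : HeightOneSpectrum (𝓞 K)) (p : ℕ) [Fact p.Prime]
  (hw : ((p : ℕ) : 𝓞 K) ∈ w.asIdeal) {Sigma : Set ℕ} {g r : ℕ}

namespace InitialThetaData

/-- **[IUTchI] Ex. 3.3 (iii) (c) for `D` AT THE ACTUAL PLACE `v̲ = w ∣ p` of `K`, at the quotient-orbicurve model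
of `Δ_C`.** ([IUTchI] Ex 3.3 (iii) p.79) [claim: Mochizuki2012, status: disputed] -/
theorem dFromF_goodLocalFrobenioidAt_of_indexTwoInv (hS : Sigma.Nonempty) (hSp : ∀ p ∈ Sigma, p.Prime)
    (hgr : PuncturedSurfaceGroup.IsHyperbolicType g r)
    (ι : PuncturedSurfaceGroup g r →* (D.geom.PiX ⊓ D.DeltaC : Subgroup D.PiC))
    (hι : IsProSigmaCompletion Sigma ι)
    (hinv : ∀ z ∈ D.DeltaC, z ∉ D.geom.PiX → ∀ x ∈ D.geom.PiX ⊓ D.DeltaC,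
      z * x * z⁻¹ * x ∈ (⁅D.geom.PiX ⊓ D.DeltaC, D.geom.PiX ⊓ D.DeltaC⁆ : Subgroup D.PiC).topologicalClosure)
    (hX : IsOpen (D.PiXarrow : Set D.PiC)) :
    @GoodLocalFrobenioid.DFromF p (RescaledCompletion K p w hw) _
      (GaloisValDatum.normVal (RescaledCompletion K p w hw)) (D.goodLocalFrobenioidAt w p hw hX) :=
  D.dFromF_goodLocalFrobenioidAt_of_geom_slim w p hw (D.isSlimGroup_deltaC_of_indexTwoInv hS hSp hgr ι hι hinv) hX

end InitialThetaData

end DatumCPlace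

end Literature.IUT.HodgeTheaters
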